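/-
Copyright (c) 2026 the pub-hodgecm-mathlib formalisation cell (harness21).  Prover seat hodgecm-mathlib-F0P3a-p02 (g23): N8-INNER brick (8) «one-place wall EP generator»,
the SPECTRAL-SIGNATURE VANISHING LEMMA (LH2-plan (g1) RE-DEAL 17:02:37Z after LHref-N (g4) BOXES #44∕#45: «(8e) at the COMPACT-wall representative»), 2026-09-02.
-/
import Literature.NumberTheory.Automorphic.UnitaryFormEigenlineWindow     -- ★ (this seat): the form-level core `Good(J,u,ρ)` — open, `U(J)`-invariant, diagonal∕isotropic criteria
import Literature.NumberTheory.Automorphic.ArchInnerFormChartLocal        -- ★ `gprimeBlockAt` (+ ★ atlas: `formSign`, `lineOf`, `splitChartPlaces`, `boostStd_mul_cayB`, `coe_gprimeCptGL`, `coe_gprimeSplitGL`)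
import HarnessLib

/-!
# The spectral-signature vanishing lemma at the compact-wall representative: no conjugate of a bad-arrangement or split chart point near `diag(u,u,v)`
# (Shelstad 1979 §4; Rogawski 1990 §8.2, §12.2; Bouaziz 1994 §2.2)

Topic `NumberTheory/Automorphic`; namespace `Literature.NumberTheory.Automorphic.UnitaryGroup`.  THEOREMS ONLY (no definition, no instance, no notation, no named fact, no `sorry`);
kernel lane `--supports stmt-HodgeConjecture-24833`.  Cell `pub/hodgecm-mathlib`, crux H413 (`stmt-HodgeConjecture-24833`), road «N8-INNER» (LEAD T14-4), brick (8e′) «wall EP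
generator at the COMPACT-wall representative» (binder LH1-p01 (g12), SIGSHEET (8e′) v1 `F0/P3c/LH1/LH1-p01/g12/brick8/SIGSHEET-8e-compact.v1.LH1p01g12.md` c193f782 §(α);
LHref-N (g4) BOX #45; dealer LH2-plan (g1) 17:02:37Z).  Count-neutral.

THE MATHEMATICS.  At an indefinite real place `w` of the frame `diag α` (`a = re σ_w α`, slots ↦ lines by `τ = lineOf (formSign)`: the two even-sign lines `τ0, τ1`, the odd
line `τ2`), the class `{u,u,v}` (`u = e^{iθ₀} ≠ v = e^{iφ₀}`) has the COMPACT-WALL representative `s = gprimeBlockAt L α w ∅ ![θ₀,θ₀,φ₀]` (repeated phase on `τ0, τ1`: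
a DEFINITE plane).  With `U₀ := Good(a(τ0)·diag(a), u, η)`, `η = ‖u − v‖∕2` — the OPEN, `G′_w`-INVARIANT set of ★ `UnitaryFormEigenlineWindow` («no non-positive eigenline with
eigenvalue in the window»), which contains `s` (its window eigenlines span the positive plane) — NO conjugate of a chart point `gprimeBlockAt L α w S′ cw` lies in `U₀` when
(A1) the label is not split-capable at `w` and the odd-line phase `e^{i cw 2}` is `η`-near `u` (the odd line is a NEGATIVE window eigenline — the «4 bad arrangements» of
BOX #45), or (A2) the label is split-capable, `cw 0 ≠ 0`, and the hyperbolic eigenvalue `e^{cw 0 + i cw 2}` is `η`-near `u` (its eigenline, column `0` of ★ `cayB` re-indexed,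
is ISOTROPIC since `|λ| = e^{cw 0} ≠ 1` — EVERY such split point).  Consequence for (δ) `ArchEPGeneratorWall`: every orbital∕chart reading of a test function with
`tsupport ⊆ U₀` vanishes at those chart points.
* **`exists_nhds_forall_conj_gprimeBlockAt_not_mem`** — SIGSHEET (8e′) §(α) TOKEN FOR TOKEN (the unused `[NumberField L] [IsCMField L]` instance binders dropped).
HONEST LABEL: HC_CM is proved only modulo the 7 printed citations (2 remaining: hLiu418 = `stmt-HodgeConjecture-24832`, h413 = `stmt-HodgeConjecture-24833`) until rung 0 closes;
linear algebra over the ★ atlas, pays nothing by itself.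

## References
* [Shelstad1979] D. Shelstad, *Characters and inner forms of a quasi-split group over ℝ*, Compositio Math. 39 (1979), §4 pp. 22–25.
* [Rogawski1990] J. D. Rogawski, *Automorphic Representations of Unitary Groups in Three Variables*, Ann. of Math. Stud. 123 (1990), §8.2 p. 119, §12.2 p. 172.
* [Bouaziz1994IntegralesOrbitales] A. Bouaziz, *Intégrales orbitales sur les groupes de Lie réductifs*, Ann. Sci. ÉNS 27 (1994), §2.2.
-/

set_option autoImplicit false

noncomputable section

open Set Filter Topology Function Matrix Complex

namespace Literature.NumberTheory.Automorphic

namespace UnitaryGroup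

/-! ## The one-place head (LH1-p01 (g12) SIGSHEET (8e′) v1 c193f782 §(α), token for token) -/

section OnePlace

open _root_.NumberField _root_.NumberField.InfinitePlace

variable (L : Type) [Field L] (α : Fin 3 → L) (w : {w : InfinitePlace L // IsComplex w})

/-- **THE SPECTRAL-SIGNATURE VANISHING LEMMA, one-place form (brick (8e′) §(α), token for token).**  `s = gprimeBlockAt L α w ∅ ![θ₀,θ₀,φ₀]` (repeated phase on the two
even-sign lines, `e^{iθ₀} ≠ e^{iφ₀}`): there are `η > 0` and `U₀ ∈ 𝓝 ↑↑s` with NO `G′_w`-conjugate of a chart point in `U₀` when (A1) the label is not split-capable at `w` and the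
ODD-line phase `e^{i cw 2}` is `η`-close to `e^{iθ₀}` (§3: a negative window eigenline), or (A2) the label is split-capable, `cw 0 ≠ 0`, and `e^{cw 0 + i cw 2}` is `η`-close
to `e^{iθ₀}` (§4: an isotropic window eigenline).  `U₀ = Good(a(τ0)·diag(a), e^{iθ₀}, ‖e^{iθ₀} − e^{iφ₀}‖∕2)`, `a = re σ_w α`.
[cite: Shelstad1979, §4 pp. 22–25] [cite: Rogawski1990, §8.2 p. 119, §12.2 p. 172] [cite: Bouaziz1994IntegralesOrbitales, §2.2] -/
theorem exists_nhds_forall_conj_gprimeBlockAt_not_mem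
    (hα : ∀ i, α i ≠ 0) (hreal : ∀ i, (w.1.embedding (α i)).im = 0) (hind : ¬ (formSign L α w 0 = formSign L α w 1 ∧ formSign L α w 1 = formSign L α w 2))
    (θ₀ φ₀ : ℝ) (hne : Complex.exp ((θ₀ : ℂ) * I) ≠ Complex.exp ((φ₀ : ℂ) * I)) :
    ∃ η > (0:ℝ), ∃ U₀ ∈ 𝓝 (((gprimeBlockAt L α w ∅ ![θ₀, θ₀, φ₀] : GL (Fin 3) ℂ) : Matrix (Fin 3) (Fin 3) ℂ)),
      (∀ (S' : Finset {w : InfinitePlace L // IsComplex w}) (cw : Fin 3 → ℝ), ¬ (w ∈ S' ∧ w ∈ splitChartPlaces L α) →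
          ‖Complex.exp ((cw 2 : ℂ) * I) - Complex.exp ((θ₀ : ℂ) * I)‖ ≤ η →
          ∀ y : ↥(archLocal L 3 (Matrix.diagonal α) w), (((y * gprimeBlockAt L α w S' cw * y⁻¹ : ↥(archLocal L 3 (Matrix.diagonal α) w)) : GL (Fin 3) ℂ) : Matrix (Fin 3) (Fin 3) ℂ) ∉ U₀) ∧
      (∀ (S' : Finset {w : InfinitePlace L // IsComplex w}) (cw : Fin 3 → ℝ), w ∈ S' → w ∈ splitChartPlaces L α → cw 0 ≠ 0 →
          ‖Complex.exp ((cw 0 : ℂ) + (cw 2 : ℂ) * I) - Complex.exp ((θ₀ : ℂ) * I)‖ ≤ η →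
          ∀ y : ↥(archLocal L 3 (Matrix.diagonal α) w), (((y * gprimeBlockAt L α w S' cw * y⁻¹ : ↥(archLocal L 3 (Matrix.diagonal α) w)) : GL (Fin 3) ℂ) : Matrix (Fin 3) (Fin 3) ℂ) ∉ U₀) := by
  classical
  -- the real form `a = re σ_w α`, the slot ↦ line map `τ`, signs along the slots
  have ha0 : ∀ i, formRe L α w i ≠ 0 := formRe_ne_zero hα hreal
  have hneg : formRe L α w (lineOf (formSign L α w) 0) * formRe L α w (lineOf (formSign L α w) 2) < 0 :=
    mul_apply_lineOf_neg (a := formRe L α w) ha0 hind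
  have hs0 : ∀ i, formSign L α w i ≠ 0 := fun i => by
    show SignType.sign (formRe L α w i) ≠ 0
    exact sign_ne_zero.2 (ha0 i)
  obtain ⟨hs1, -⟩ := sign_apply_lineOf (s := formSign L α w) (hs0 0) (hs0 1) (hs0 2) hind
  have hpos1 : 0 < formRe L α w (lineOf (formSign L α w) 0) * formRe L α w (lineOf (formSign L α w) 1) := by
    have h1 : SignType.sign (formRe L α w (lineOf (formSign L α w) 1)) = SignType.sign (formRe L α w (lineOf (formSign L α w) 0)) := hs1
    rcases lt_or_gt_of_ne (ha0 (lineOf (formSign L α w) 0)) with h0 | h0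
    · have : formRe L α w (lineOf (formSign L α w) 1) < 0 := sign_eq_neg_one_iff.1 (h1.trans (sign_eq_neg_one_iff.2 h0))
      exact mul_pos_of_neg_of_neg h0 this
    · have : 0 < formRe L α w (lineOf (formSign L α w) 1) := sign_eq_one_iff.1 (h1.trans (sign_eq_one_iff.2 h0))
      exact mul_pos h0 this
  have hpos0 : 0 < formRe L α w (lineOf (formSign L α w) 0) * formRe L α w (lineOf (formSign L α w) 0) := mul_self_pos.2 (ha0 _)
  -- the form at `w`, `J = diag(a)`, and its POSITIVE multiple `J' = a(τ0) • J = diag(a')` whose even lines are positive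
  set a' : Fin 3 → ℝ := fun i => formRe L α w (lineOf (formSign L α w) 0) * formRe L α w i with ha'
  have hJw : (Matrix.diagonal α).map w.1.embedding = Matrix.diagonal fun i => ((formRe L α w i : ℝ) : ℂ) := diagonal_map_embedding_eq_of_real hreal
  have hJ' : ((formRe L α w (lineOf (formSign L α w) 0) : ℝ) : ℂ) • (Matrix.diagonal fun i => ((formRe L α w i : ℝ) : ℂ)) =
      Matrix.diagonal fun i => ((a' i : ℝ) : ℂ) := by
    rw [← Matrix.diagonal_smul]
    congr 1
    funext i
    rw [Pi.smul_apply, smul_eq_mul, ha', Complex.ofReal_mul]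
  have hmemJ' : ∀ y : ↥(archLocal L 3 (Matrix.diagonal α) w), (y : GL (Fin 3) ℂ) ∈ unitaryGroupOfForm (starRingEnd ℂ) (Matrix.diagonal fun i => ((a' i : ℝ) : ℂ)) := by
    intro y
    have hy : (y : GL (Fin 3) ℂ) ∈ unitaryGroupOfForm (starRingEnd ℂ) ((Matrix.diagonal α).map w.1.embedding) := y.2
    rw [hJw] at hy
    rw [← hJ']
    exact mem_unitaryGroupOfForm_smul hy _
  -- the window: `u = e^{iθ₀}`, `v = e^{iφ₀}`, `η = ‖u − v‖ ∕ 2`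
  have huv : 0 < ‖Complex.exp ((θ₀ : ℂ) * I) - Complex.exp ((φ₀ : ℂ) * I)‖ := norm_pos_iff.2 (sub_ne_zero.2 hne)
  set η : ℝ := ‖Complex.exp ((θ₀ : ℂ) * I) - Complex.exp ((φ₀ : ℂ) * I)‖ / 2 with hη
  have hη0 : 0 < η := by rw [hη]; positivity
  -- conjugates read as matrix products
  have hconj : ∀ (y t : ↥(archLocal L 3 (Matrix.diagonal α) w)),
      (((y * t * y⁻¹ : ↥(archLocal L 3 (Matrix.diagonal α) w)) : GL (Fin 3) ℂ) : Matrix (Fin 3) (Fin 3) ℂ) =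
        ((y : GL (Fin 3) ℂ) : Matrix (Fin 3) (Fin 3) ℂ) * ((t : GL (Fin 3) ℂ) : Matrix (Fin 3) (Fin 3) ℂ) * (((y : GL (Fin 3) ℂ)⁻¹ : GL (Fin 3) ℂ) : Matrix (Fin 3) (Fin 3) ℂ) := by
    intro y t
    rw [Subgroup.coe_mul, Subgroup.coe_mul, Subgroup.coe_inv, Units.val_mul, Units.val_mul]
  refine ⟨η, hη0, {x : Matrix (Fin 3) (Fin 3) ℂ | ∀ (ξ : Fin 3 → ℂ) (μ : ℂ), x *ᵥ ξ = μ • ξ → ‖μ - Complex.exp ((θ₀ : ℂ) * I)‖ ≤ η →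
      (star ξ ⬝ᵥ (Matrix.diagonal fun i => ((a' i : ℝ) : ℂ)) *ᵥ ξ).re ≤ 0 → ξ = 0}, ?_, ?_, ?_⟩
  · -- `U₀` is an open neighbourhood of `s` (§1 + §3)
    refine (isOpen_setOf_forall_eigenvector_re_pos _ _ _).mem_nhds ?_
    rw [show gprimeBlockAt L α w ∅ ![θ₀, θ₀, φ₀] = gprimeBlock L α w ∅ (fun _ => ![θ₀, θ₀, φ₀]) from rfl,
      coe_gprimeBlock_of_not_mem L α _ (Finset.notMem_empty w), coe_gprimeCptGL]
    refine diagonal_mem_setOf_forall_eigenvector a' _ _ η fun ℓ hℓ => ?_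
    -- `ℓ = τ k`; `k = 2` is the `v`-line, outside the window; `k = 0, 1` are even, `a' > 0`
    obtain ⟨k, rfl⟩ : ∃ k, lineOf (formSign L α w) k = ℓ := ⟨(lineOf (formSign L α w)).symm ℓ, Equiv.apply_symm_apply _ _⟩
    rw [Equiv.symm_apply_apply] at hℓ
    fin_cases k
    · exact hpos0
    · exact hpos1
    · exfalso
      have h2 : ((![θ₀, θ₀, φ₀] : Fin 3 → ℝ) 2 : ℝ) = φ₀ := rfl
      simp only [Fin.reduceFinMk, h2] at hℓ
      rw [norm_sub_rev] at hℓ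
      rw [hη] at hℓ
      linarith
  · -- (A1): the ODD line `τ 2` carries a window phase and is NEGATIVE for `J'`
    intro S' cw hns hcw y
    have ht : (((gprimeBlockAt L α w S' cw : ↥(archLocal L 3 (Matrix.diagonal α) w)) : GL (Fin 3) ℂ) : Matrix (Fin 3) (Fin 3) ℂ) =
        Matrix.diagonal fun ℓ => Complex.exp ((cw ((lineOf (formSign L α w)).symm ℓ) : ℂ) * I) := by
      rw [show gprimeBlockAt L α w S' cw = gprimeBlock L α w S' (fun _ => cw) from rfl]
      by_cases hS : w ∈ S'
      · rw [coe_gprimeBlock_of_not_mem_splitChartPlaces L α _ (fun hsp => hns ⟨hS, hsp⟩), coe_gprimeCptGL]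
      · rw [coe_gprimeBlock_of_not_mem L α _ hS, coe_gprimeCptGL]
    have hbad := diagonal_not_mem_setOf_forall_eigenvector a' (fun ℓ => Complex.exp ((cw ((lineOf (formSign L α w)).symm ℓ) : ℂ) * I))
      (Complex.exp ((θ₀ : ℂ) * I)) η (k := lineOf (formSign L α w) 2) (by simpa only [Equiv.symm_apply_apply] using hcw) hneg.le
    rw [hconj, ht]
    exact forall_conj_not_mem_of_not_mem _ _ η hbad subset_rfl (hmemJ' y)
  · -- (A2): the hyperbolic eigenline of the split chart point is ISOTROPIC, eigenvalue `e^{cw 0 + i cw 2}` not unimodular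
    intro S' cw hS hsp hc0 hcw y
    have hb : (formRe L α w ∘ lineOf (formSign L α w)) 0 * (formRe L α w ∘ lineOf (formSign L α w)) 2 < 0 := hsp.2
    have ht : (((gprimeBlockAt L α w S' cw : ↥(archLocal L 3 (Matrix.diagonal α) w)) : GL (Fin 3) ℂ) : Matrix (Fin 3) (Fin 3) ℂ) =
        (boostStd (formRe L α w ∘ lineOf (formSign L α w)) cw).submatrix (lineOf (formSign L α w)).symm (lineOf (formSign L α w)).symm := by
      rw [show gprimeBlockAt L α w S' cw = gprimeBlock L α w S' (fun _ => cw) from rfl, coe_gprimeBlock_of_mem L α _ hS hsp, coe_gprimeSplitGL]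
      rfl
    -- the eigenvector: column 0 of `cayB`, re-indexed to the lines
    set ξ : Fin 3 → ℂ := fun ℓ => cayB (formRe L α w ∘ lineOf (formSign L α w)) ((lineOf (formSign L α w)).symm ℓ) 0 with hξ
    have hcol : boostStd (formRe L α w ∘ lineOf (formSign L α w)) cw *ᵥ (fun k => cayB (formRe L α w ∘ lineOf (formSign L α w)) k 0) =
        boostEig cw 0 • (fun k => cayB (formRe L α w ∘ lineOf (formSign L α w)) k 0) := by
      funext i
      have h := congrFun (congrFun (boostStd_mul_cayB hb cw) i) 0
      rw [Matrix.mul_diagonal, Matrix.mul_apply] at h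
      rw [Pi.smul_apply, smul_eq_mul, mul_comm]
      simpa [mulVec, dotProduct] using h
    have hx : (((gprimeBlockAt L α w S' cw : ↥(archLocal L 3 (Matrix.diagonal α) w)) : GL (Fin 3) ℂ) : Matrix (Fin 3) (Fin 3) ℂ) *ᵥ ξ = boostEig cw 0 • ξ := by
      rw [ht, Matrix.submatrix_mulVec_equiv]
      have hcomp : ξ ∘ ⇑(lineOf (formSign L α w)).symm.symm = fun k => cayB (formRe L α w ∘ lineOf (formSign L α w)) k 0 := by
        funext k; simp only [hξ, Function.comp_apply, Equiv.symm_symm, Equiv.symm_apply_apply]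
      rw [hcomp, hcol]
      funext ℓ
      simp only [Function.comp_apply, Pi.smul_apply, hξ]
    have hξ0 : ξ ≠ 0 := by
      intro h0
      have := congrFun h0 (lineOf (formSign L α w) 2)
      simp [hξ, cayB] at this
    have hμ1 : ‖boostEig cw 0‖ ≠ 1 := by
      have e1 : boostEig cw 0 = Complex.exp ((cw 0 : ℂ) + (cw 2 : ℂ) * I) := rfl
      rw [e1, Complex.norm_exp]
      simp only [Complex.add_re, Complex.ofReal_re, Complex.mul_re, Complex.I_re, Complex.I_im, Complex.ofReal_im, mul_zero, sub_zero,
        mul_one, add_zero]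
      exact fun h => hc0 (Real.exp_eq_one_iff _ |>.1 h)
    have hiso : (star ξ ⬝ᵥ (Matrix.diagonal fun i => ((a' i : ℝ) : ℂ)) *ᵥ ξ).re = 0 := by
      rw [star_dotProduct_mulVec_eq_zero_of_norm_ne_one (hmemJ' _) hx hμ1, Complex.zero_re]
    have hbad := not_mem_setOf_forall_eigenvector_of_isotropic (Matrix.diagonal fun i => ((a' i : ℝ) : ℂ)) (Complex.exp ((θ₀ : ℂ) * I)) η hξ0 hx
      (by exact hcw) hiso
    rw [hconj]
    exact forall_conj_not_mem_of_not_mem _ _ η hbad subset_rfl (hmemJ' y)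

end OnePlace

end UnitaryGroup

end Literature.NumberTheory.Automorphic

end
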